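import Summits.Ventures.CertifiedManyBodySolver.Lower.PauliDoublonBlock
import Summits.Ventures.CertifiedManyBodySolver.Lower.PauliDoublonLevelProj
import Summits.Ventures.CertifiedManyBodySolver.Lower.PauliDoublonOperatorIdentity
import Literature.MathematicalPhysics.QuantumLattice.HubbardLangerMattisFermiSum
import Literature.MathematicalPhysics.QuantumLattice.HubbardRingPerronFrobeniusProofs
import HarnessLib

/-!
# Ventures/CertifiedManyBodySolver — Lower/PauliDoublonFloor.lean: the Pauli–doublon floor = Langer–Mattis' species split off half filling (every torus, and the 2D thermodynamic limit)

HONEST FRAMING: first certified bounds; not a superconductivity verdict; every number certified or labelled float.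

**What is proved (kernel-checked, no hypothesis left).** For the Hubbard model on the torus `(ℤ/Lℤ)^d`,
`L ≥ 3`, hopping `t`, coupling `U` (any signs on the torus), and for ALL real multipliers `α, ν`:

* `torusBound_holds` (THEOREM D): for every `m ≤ L^d`,
  `E_L(2m) ≥ −2 (α m + Σ_k s̃(ε_k; m/L^d, α, ν, U))`, `ε_k = −2t Σ_i cos k_i` the band of Langer–Mattis'
  frozen one-body matrix `A_w = −tA + (U/2)1_w`, where `s̃ = blockFloor` is the sum of the negative parts
  of the two eigenvalues of the explicit real symmetric block `K^{1/2} [[ε+α, ε+ν],[ε+ν, ε+α+U/2]] K^{1/2}`,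
  `K = diag(1−κ, κ)`, `κ = m/L^d` (closed form);
* `tlBoundRat_holds` (THEOREM E, `d = 2`, `U ≥ 0`, every RATIONAL density `0 ≤ n < 2`):
  `e(t, U, n) ≥ −2 (α n/2 + (2π)⁻² ∫_{[−π,π]²} s̃(2t(cos p₁ + cos p₂); U, n/2, α, ν) dp)` for the tree's
  thermodynamic-limit energy density `energyDensity2D t U n`.

Weak duality only: EVERY `(α, ν)` gives a valid floor, so a certified NUMBER at a cell needs no optimality
argument — two interval-arithmetic quadratures of one explicit Lipschitz integrand at a rational `(α, ν)`
plus a referee (GRID class K, exactly like the tree's Langer–Mattis floors). At half filling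
(`n = 1`, `α = −U/4`, `ν = 0`) the bound is the Langer–Mattis / Kennedy–Lieb bound of
`HubbardLangerMattisBound.lean` (`LangerMattis.energyDensity2D_ge`); off half filling it re-optimises
`(α, ν)` instead of transporting the half-filled chessboard.

**Architecture (B ⇒ C″ ⇒ C ⇒ D ⇒ E).** (B) `rankTwoFloorQF_holds` (`Lower/PauliDoublonBlock.lean`): a floor on the `2 × 2` quadratic form
`tr(C G)` over `0 ⪯ G ⪯ K` (pure real algebra: the spectral projections of the block pulled back to
`G`-space). (C″) `densityMatrixFloor_holds`: for every one-body density matrix `0 ⪯ γ ⪯ 1`,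
`Re Tr(A_w γ) ≥ −α Re Tr γ − Σ_k s̃(ε_k; |w|/L^d, …)`, from the OPERATOR IDENTITY
`re_trace_lmOneBody_mul_add` (`Lower/PauliDoublonOperatorIdentity.lean`): `A_w + α = Σ_k M_k` with `M_k` the rank-two block on `(Π_{wᶜ} e_k, Π_w e_k)`,
`e_k` the site plane waves [cite: FriedliVelenikSMLS2017, §10.5.2] — the frozen configuration `w` enters
ONLY through `|w|`, because `|e_k(x)|² = L^{−d}` makes the Gram matrix of `(Π_{wᶜ} e_k, Π_w e_k)` equal to
`diag(1 − |w|/L^d, |w|/L^d)` for every `k` and every `w` of that size, and `Π_{wᶜ} Π_w = 0` kills the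
`ν`-term identically (the Harris–Lange spectral-weight caps [cite: HarrisLange1967, §III] read as Loewner
bounds). (C) `fermiSumFloor_holds`: the same floor for every level sum `Σ_{i∈I} λ_i(A_w)` (spectral
projection `levelProj`, `Lower/PauliDoublonLevelProj.lean`). (D) `torusBound_holds`: (C) fed as both species constants into the tree's
sector-kept Langer–Mattis assembly `LangerMattis.fermiSum_mul_normSq_le_re_rayleigh_hamiltonian_of_isInSector`
[cite: LangerMattis1971, eqs. (4)–(5)] on a ground state of the balanced sector, with Lieb's `S^z = 0`
representative theorem `groundEnergyAt_eq_minEnergyOn_szSector`. (E) `tlBoundRat_holds`: along the tori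
`L = 2q(j+2)`, on which `⌊nL²/2⌋ = nL²/2` exactly, by the proof pattern of `LangerMattis.energyDensity2D_ge`
(Riemann sums → the Brillouin-zone integral; the `(π, π)` shift `latticeMomentum = cellCorner + π` flips the
sign of `t` in the integrand, `pdbIntegrand_add_pi`).

**Placement in print (LIT lane, hubbard-alg; HOME/INBOX l.16400).** Half filling: Langer–Mattis 1971
[cite: LangerMattis1971, eqs. (3)–(5)], frozen-species minimum = Kennedy–Lieb 1986
[cite: KennedyLieb1986, Theorem 2.1] (tree: `FalicovKimballChessboardBound.lean`,
[cite: LiebLoss1993, §8, Theorem 8.2]). Off half filling the MECHANISM is in print: Valentí–Stolze–Hirschfeld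
1991 [cite: ValentiStolzeHirschfeld1991, abstract, bound type (b): the up/down split using previous results
on the spinless Falicov–Kimball model, arbitrary band filling and coupling], whose Falicov–Kimball input is
of the Brandt–Schmidt kind [cite: BrandtSchmidt1986, main theorem]; whether the `|w|`-only closed form `s̃`
below equals, sharpens or is weaker than that printed input is UNREAD at the time of writing (acquisition
requests open) — so this file claims a kernel-checked THEOREM of that printed class, not a result new in
print.
-- NOTE: the all-real-density TL statement `TLBound` / `tlBound_holds` lives in part 5 `Lower/PauliDoublonRealDensity.lean`; the
-- matrix-dress form `0 ⪯ G ⪯ K ⇒ tr(CG) ≥ −s̃` of (B) is not needed by the chain and is not stated here.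

Provenance: mathematics, statements and Lean proofs by hubbard-alg L3 seat B
(planner-sr-mbsolver-l3-idea-2 g25/g26; `HOME/hubbard-alg/L3-hybrid/tools-seatB/pdbl/NOTE-PDB-L.md` §1/§6,
`PauliDoublonSketch.lean` v6 sha16 54e19fa031dc4b1e, 0 sorries); tree placement, print placement and
citations by the LIT lane (literature-prover lit-1 g22). 0 facts: every `def … : Prop` below has its
`_holds` theorem in this file.

## References
* [LangerMattis1971] W. D. Langer, D. C. Mattis, Phys. Lett. A 36 (1971) 139, eqs. (3)–(5).
* [KennedyLieb1986] T. Kennedy, E. H. Lieb, Physica A 138 (1986) 320, Theorem 2.1.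
* [LiebLoss1993] E. H. Lieb, M. Loss, Duke Math. J. 71 (1993) 337, §8.
* [HarrisLange1967] A. B. Harris, R. V. Lange, Phys. Rev. 157 (1967) 295, §III (spectral-weight sum rules).
* [ValentiStolzeHirschfeld1991] R. Valentí, J. Stolze, P. J. Hirschfeld, Phys. Rev. B 43 (1991) 13743, bound type (b).
* [BrandtSchmidt1986] U. Brandt, R. Schmidt, Z. Phys. B 63 (1986) 45.
* [FriedliVelenikSMLS2017] S. Friedli, Y. Velenik, Statistical Mechanics of Lattice Systems (CUP, 2017), §10.5.2.
-/

noncomputable section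

namespace Summit.Ventures.CertifiedManyBodySolver.Lower

namespace PauliDoublon

open Literature.MathematicalPhysics.QuantumLattice
open Matrix Finset Filter Literature.Probability.LatticeModels ThermodynamicLimit LangerMattis MeasureTheory
open scoped Topology ComplexOrder

/-- LEMMA C (the one new spectral lemma): on the torus `(ℤ/Lℤ)^d`, `L ≥ 3`, every `a`-level sum of
Langer–Mattis' frozen one-body matrix `A_w = -tA + (U/2)1_w` is bounded below by a function of
`(a, |w|)` alone: `Σ_{i∈I} λ_i(A_w) ≥ -α|I| - Σ_k s̃(ε_k; |w|/L^d, α, ν, U)` for all real `α, ν`. [folklore] -/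
def FermiSumFloor : Prop :=
  ∀ (d L : ℕ) [NeZero L], 3 ≤ L → ∀ (t U α ν : ℝ) (w I : Finset (FermionTorus d L)),
    -(α * I.card) -
        ∑ k : TorusSite d L, pdbIntegrand t U ((w.card : ℝ) / (L : ℝ) ^ d) α ν (latticeMomentum L k) ≤
      ∑ i ∈ I, (isHermitian_lmOneBody (fermionTorusGraph d L) t U w).eigenvalues i

/-- LEMMA C″ (density-matrix form of LEMMA C, the tree idiom of
`FalicovKimball.kennedyLieb_re_trace_mul_ge`): for every one-body density matrix `0 ⪯ γ ⪯ 1`,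
`Re Tr(A_w γ) ≥ -α Re Tr γ - Σ_k s̃(ε_k; |w|/L^d, α, ν, U)`. LEMMA C is the case `γ = P_I` (the
spectral projection of `A_w` onto the levels `I`: `Re Tr(A_w P_I) = Σ_{i∈I} λ_i`, `Tr P_I = |I|`). [folklore] -/
def DensityMatrixFloor : Prop :=
  ∀ (d L : ℕ) [NeZero L], 3 ≤ L → ∀ (t U α ν : ℝ) (w : Finset (FermionTorus d L))
    (γ : Matrix (FermionTorus d L) (FermionTorus d L) ℂ), γ.PosSemidef → (1 - γ).PosSemidef →
    -(α * (Matrix.trace γ).re) -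
        ∑ k : TorusSite d L, pdbIntegrand t U ((w.card : ℝ) / (L : ℝ) ^ d) α ν (latticeMomentum L k) ≤
      (Matrix.trace (lmOneBody (fermionTorusGraph d L) t U w * γ)).re

/-- THEOREM D (PDB-L on the torus, balanced sector; from `FermiSumFloor` +
`fermiSum_mul_normSq_le_re_rayleigh_hamiltonian_of_isInSector` at `(m, m)` +
`groundEnergyAt_eq_minEnergyOn_szSector`): for `L ≥ 3`, all real `t, U, α, ν` and `m ≤ L^d`,
`E_L(2m) ≥ -2 (α m + Σ_k s̃(ε_k; m/L^d, α, ν, U))`. No bipartiteness, no sign of `t`, `U`. [folklore] [cite: LangerMattis1971, eqs. (4)–(5) (the half-filled case)] -/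
def TorusBound : Prop :=
  ∀ (d L : ℕ) [NeZero L], 3 ≤ L → ∀ (t U α ν : ℝ) (m : ℕ), m ≤ L ^ d →
    -(2 * (α * m +
        ∑ k : TorusSite d L, pdbIntegrand t U ((m : ℝ) / (L : ℝ) ^ d) α ν (latticeMomentum L k))) ≤
      groundEnergyAt (fermionTorusGraph d L) t U (2 * m)


/-! ### Glue (kernel-checked): (D) follows from (C) by the tree's Langer–Mattis species
split kept sector by sector and Lieb's `S^z = 0` representative theorem. -/

open Literature.MathematicalPhysics.QuantumLattice.RayleighBound in
/-- **(C) ⇒ (D).** `FermiSumFloor → TorusBound`: feed the level-sum floor at `|w| = |I| = m` as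
both `c₀` and `c₁` into `fermiSum_mul_normSq_le_re_rayleigh_hamiltonian_of_isInSector` on a ground
state of the balanced sector `(m, m)` (`upDownSector_groundState`), and identify that sector energy
with `E_L(2m)` (`groundEnergyAt_eq_minEnergyOn_szSector`, `szSector_two_mul_zero_eq`). [cite: LangerMattis1971, eqs. (4)–(5)] -/
theorem torusBound_of_fermiSumFloor (hC : FermiSumFloor) : TorusBound := by
  classical
  intro d L _ hL t U α ν m hm
  have hcard : Fintype.card (FermionTorus d L) = L ^ d := LangerMattis.card_fermionTorus_eq
  have hmc : m ≤ Fintype.card (FermionTorus d L) := hcard ▸ hm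
  set S : ℝ := ∑ k : TorusSite d L,
      pdbIntegrand t U ((m : ℝ) / (L : ℝ) ^ d) α ν (latticeMomentum L k) with hS
  -- (C) at `|w| = |I| = m`
  have h₀ : ∀ w : Finset (FermionTorus d L), w.card = m →
      ∀ I : Finset (FermionTorus d L), I.card = m →
        -(α * m + S) ≤ ∑ i ∈ I, (isHermitian_lmOneBody (fermionTorusGraph d L) t U w).eigenvalues i := by
    intro w hw I hI
    have h := hC d L hL t U α ν w I
    rw [hw, hI] at h
    linarith [h, hS]
  -- a ground state of the balanced sector `(m, m)`
  obtain ⟨⟨χ, hχsec, hχ0, hHχ⟩, -⟩ := upDownSector_groundState (fermionTorusGraph d L) t U hmc hmc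
  set E : ℝ := (hamiltonian (fermionTorusGraph d L) t U).minEnergyOn
      (szSector (m + m) (((m : ℝ) - m) / 2)) with hE
  have hfs := LangerMattis.fermiSum_mul_normSq_le_re_rayleigh_hamiltonian_of_isInSector
    (fermionTorusGraph d L) t U hχsec h₀ h₀
  have hre : (star χ ⬝ᵥ (hamiltonian (fermionTorusGraph d L) t U *ᵥ χ)).re = E * normSq χ := by
    rw [hHχ, dotProduct_smul, star_dotProduct_self_eq_normSq, smul_eq_mul, ← Complex.ofReal_mul,
      Complex.ofReal_re]
  have hpos : 0 < normSq χ :=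
    lt_of_le_of_ne (normSq_nonneg χ) fun h0 => hχ0 (LangerMattis.eq_zero_of_normSq_eq_zero h0.symm)
  rw [hre] at hfs
  have hle : -(α * m + S) + -(α * m + S) ≤ E := le_of_mul_le_mul_right hfs hpos
  -- `E_L(2m)` is the balanced-sector energy (every spin multiplet is represented at `S^z = 0`)
  have hGS : groundEnergyAt (fermionTorusGraph d L) t U (2 * m) = E := by
    rw [hE, groundEnergyAt_eq_minEnergyOn_szSector (fermionTorusGraph d L) t U hmc,
      szSector_two_mul_zero_eq]
  rw [hGS]
  linarith


/-! ### Skeleton glue (kernel-checked): (E) at every RATIONAL density follows from (D) along the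
tori `L = 2q(j+2)`, on which `N_L(n)/2 = nL²/2` exactly (no Lipschitz-in-`κ` estimate), by the
proof of `LangerMattis.energyDensity2D_ge` with the Riemann-sum dictionary read through
`latticeMomentum = cellCorner + (π,π)` (the PDB integrand is not `(π,π)`-invariant: the shift flips
the sign of `t`, so the Brillouin-zone integral appears with `pdbIntegrand (-t)`; it equals the
`t`-integral by the measure-preserving shift `p ↦ p + (π,π)` of the zone — not proved here). -/

/-- (E) at rational densities, Brillouin-zone integrand written at `-t` (see the section docstring):
for `U ≥ 0`, `0 ≤ n = a/q < 2` and ALL real `α, ν`,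
`e(t,U,n) ≥ -2 (α n/2 + (2π)⁻² ∫_{[-π,π]²} s̃(+2t(cos p₁+cos p₂); n/2, α, ν, U) dp)`. [folklore] -/
def TLBoundRat : Prop :=
  ∀ (t : ℝ) (U : ℝ), 0 ≤ U → ∀ (n : ℝ), 0 ≤ n → n < 2 → (∃ a q : ℕ, 0 < q ∧ n = a / q) →
    ∀ (α ν : ℝ),
    -(2 * (α * (n / 2) +
        ((2 * Real.pi) ^ 2)⁻¹ * ∫ p in brillouin 2, pdbIntegrand (-t) U (n / 2) α ν p)) ≤
      energyDensity2D t U n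

/-- **(D) ⇒ (E) at rational densities.** `TorusBound → TLBoundRat`. [cite: LangerMattis1971, eq. (3) (the half-filled pattern `LangerMattis.energyDensity2D_ge`)] -/
theorem tlBoundRat_of_torusBound (hD : TorusBound) : TLBoundRat := by
  intro t U hU n hn0 hn2 hrat α ν
  obtain ⟨a, q, hq, hnq⟩ := hrat
  have hq' : (q : ℝ) ≠ 0 := by exact_mod_cast hq.ne'
  -- the tori `L = 2q(j+2)`
  set φ : ℕ → ℕ := fun j => 2 * q * (j + 2) with hφdef
  have hφ3 : ∀ j, 3 ≤ φ j := fun j => by simp only [hφdef]; nlinarith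
  have hφ : Tendsto φ atTop atTop :=
    tendsto_atTop_atTop.2 fun b => ⟨b, fun j hj => by simp only [hφdef]; nlinarith⟩
  have hlim : Tendsto (fun j => groundEnergyAt (fermionTorusGraph 2 (φ j)) t U (rectN n (φ j)) /
      ((φ j : ℕ) : ℝ) ^ 2) atTop (𝓝 (energyDensity2D t U n)) :=
    (tendsto_energyDensity2D_torus t hU hn0 hn2).comp hφ
  -- on these tori the particle count is exact: `⌊n L²/2⌋ = n L²/2`
  have hfloor : ∀ j, ((⌊n * ((φ j : ℕ) : ℝ) ^ 2 / 2⌋₊ : ℕ) : ℝ) = n / 2 * ((φ j : ℕ) : ℝ) ^ 2 := by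
    intro j
    have hx : n * ((φ j : ℕ) : ℝ) ^ 2 / 2 = ((2 * a * q * (j + 2) ^ 2 : ℕ) : ℝ) := by
      rw [hnq]
      simp only [hφdef]
      push_cast
      field_simp
    rw [hx, Nat.floor_natCast, ← hx]
    ring
  -- the Riemann sums of the (shifted) integrand converge
  set G : (Fin 2 → ℝ) → ℝ := pdbIntegrand (-t) U (n / 2) α ν with hGdef
  have hG : ContinuousOn G (brillouin 2) := (continuous_pdbIntegrand _ _ _ _ _).continuousOn
  have hRS : Tendsto (fun j => ((2 * Real.pi) ^ 2)⁻¹ * cornerRiemannSum G (φ j)) atTop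
      (𝓝 (((2 * Real.pi) ^ 2)⁻¹ * ∫ p in brillouin 2, G p)) :=
    ((tendsto_cornerRiemannSum hG).comp hφ).const_mul _
  have hb : Tendsto (fun j => -(2 * (α * (n / 2) + ((2 * Real.pi) ^ 2)⁻¹ * cornerRiemannSum G (φ j))))
      atTop (𝓝 (-(2 * (α * (n / 2) + ((2 * Real.pi) ^ 2)⁻¹ * ∫ p in brillouin 2, G p)))) :=
    ((hRS.const_add _).const_mul _).neg
  refine le_of_tendsto_of_tendsto hb hlim (Eventually.of_forall fun j => ?_)
  dsimp only
  have hL3 : 3 ≤ φ j := hφ3 j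
  haveI : NeZero (φ j) := ⟨by omega⟩
  have hL2 : (0 : ℝ) < ((φ j : ℕ) : ℝ) ^ 2 := by
    have hLpos : (0 : ℝ) < ((φ j : ℕ) : ℝ) := by exact_mod_cast (show 0 < φ j by omega)
    positivity
  -- `N_L = 2 m`, `m ≤ L²`, `m / L² = n / 2`
  set m : ℕ := ⌊n * ((φ j : ℕ) : ℝ) ^ 2 / 2⌋₊ with hmdef
  have hrect : rectN n (φ j) = 2 * m := rfl
  have hmle : m ≤ φ j ^ 2 := by
    have h1 := rectN_le_two_mul hn0 hn2.le (φ j)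
    rw [hrect] at h1
    have h2 : m ≤ φ j * φ j := Nat.le_of_mul_le_mul_left h1 (by norm_num)
    simpa [sq] using h2
  have hm : (m : ℝ) = n / 2 * ((φ j : ℕ) : ℝ) ^ 2 := by rw [hmdef]; exact hfloor j
  have hκ : (m : ℝ) / ((φ j : ℕ) : ℝ) ^ 2 = n / 2 := by
    rw [hm, mul_div_assoc, div_self hL2.ne', mul_one]
  have hDj := hD 2 (φ j) hL3 t U α ν m hmle
  rw [hκ] at hDj
  -- the momentum sum is a corner Riemann sum of `G`
  have hsum : ∑ k : TorusSite 2 (φ j), pdbIntegrand t U (n / 2) α ν (latticeMomentum (φ j) k) =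
      ∑ k : TorusSite 2 (φ j), G (cellCorner k) := by
    refine Finset.sum_congr rfl fun k _ => ?_
    rw [latticeMomentum_eq_cellCorner_add, pdbIntegrand_add_pi, hGdef]
  have havg := sum_cellCorner_div_eq (d := 2) (L := φ j) G
  have hS : ∑ k : TorusSite 2 (φ j), G (cellCorner k) =
      ((2 * Real.pi) ^ 2)⁻¹ * cornerRiemannSum G (φ j) * ((φ j : ℕ) : ℝ) ^ 2 := by
    rw [← havg, div_mul_cancel₀ _ hL2.ne']
  rw [hrect, le_div_iff₀ hL2]
  have key : -(2 * (α * (n / 2) + ((2 * Real.pi) ^ 2)⁻¹ * cornerRiemannSum G (φ j))) *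
        ((φ j : ℕ) : ℝ) ^ 2 =
      -(2 * (α * m + ∑ k : TorusSite 2 (φ j), pdbIntegrand t U (n / 2) α ν (latticeMomentum (φ j) k))) := by
    rw [hsum, hS, hm]
    ring
  rw [key]
  exact hDj


/-- **(C″) ⇒ (C).** `DensityMatrixFloor → FermiSumFloor`, by the spectral projection `P_I`. [folklore] -/
theorem fermiSumFloor_of_densityMatrixFloor (h : DensityMatrixFloor) : FermiSumFloor := by
  intro d L _ hL t U α ν w I
  have hA := isHermitian_lmOneBody (fermionTorusGraph d L) t U w
  have key := h d L hL t U α ν w (levelProj hA I) (levelProj_posSemidef hA I)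
    (one_sub_levelProj_posSemidef hA I)
  rw [re_trace_levelProj, re_trace_mul_levelProj] at key
  exact key


section Assemble

variable {d L : ℕ} [NeZero L]


/-- **(B) ⇒ (C″).** `RankTwoFloorQF → DensityMatrixFloor`: LEMMA A traced against `γ`, the
per-momentum `2×2` data of `γ` (`rankTwo_data`), and LEMMA B momentum by momentum. [folklore] -/
theorem densityMatrixFloor_of_rankTwoFloorQF (hB : RankTwoFloorQF) : DensityMatrixFloor := by
  intro d L _ hL t U α ν w γ hγ hγ'
  have key := re_trace_lmOneBody_mul_add hL t U α ν w hγ.1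
  have hk : ∀ k : FermionTorus d L,
      -blockFloor (-siteBand t k) U ((w.card : ℝ) / (L : ℝ) ^ d) α ν ≤
        (-siteBand t k + α) * gFF w γ k + 2 * (-siteBand t k + ν) * gFO w γ k +
          (-siteBand t k + α + U / 2) * gOO w γ k := by
    intro k
    obtain ⟨h1, h2⟩ := rankTwo_data w k hγ hγ'
    exact hB _ _ _ _ _ _ _ _ h1 h2
  have hsum := Finset.sum_le_sum fun k (_ : k ∈ (Finset.univ : Finset (FermionTorus d L))) => hk k
  have hconv : ∑ z : TorusSite d L, pdbIntegrand t U ((w.card : ℝ) / (L : ℝ) ^ d) α ν (latticeMomentum L z) =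
      ∑ k : FermionTorus d L, blockFloor (-siteBand t k) U ((w.card : ℝ) / (L : ℝ) ^ d) α ν := by
    rw [FermionTorus.sum_eq_sum_torusSite]
    simp only [pdbIntegrand, siteBand, FermionTorus.toTorusSite_ofTorusSite]
  rw [hconv]
  rw [Finset.sum_neg_distrib] at hsum
  linarith [hsum, key]

end Assemble


/-! ### The chain, composed modulo the 2×2 lemma (proved below). -/

/-- **PDB-L on every torus, GIVEN the 2×2 lemma.** [folklore] -/
theorem torusBound_of_rankTwoFloorQF (hB : RankTwoFloorQF) : TorusBound :=
  torusBound_of_fermiSumFloor (fermiSumFloor_of_densityMatrixFloor (densityMatrixFloor_of_rankTwoFloorQF hB))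

/-- **PDB-L in the thermodynamic limit at every rational density, GIVEN the 2×2 lemma.** [folklore] -/
theorem tlBoundRat_of_rankTwoFloorQF (hB : RankTwoFloorQF) : TLBoundRat :=
  tlBoundRat_of_torusBound (torusBound_of_rankTwoFloorQF hB)

/-! ### The chain, UNCONDITIONAL: (B) proved ⇒ (C″) ⇒ (C) ⇒ (D) ⇒ (E_rat). -/

/-- LEMMA C″ (density-matrix floor), unconditionally. [folklore] -/
theorem densityMatrixFloor_holds : DensityMatrixFloor :=
  densityMatrixFloor_of_rankTwoFloorQF rankTwoFloorQF_holds

/-- LEMMA C (Fermi-sum floor), unconditionally. [folklore] -/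
theorem fermiSumFloor_holds : FermiSumFloor :=
  fermiSumFloor_of_densityMatrixFloor densityMatrixFloor_holds

/-- **PDB-L on every torus** (`L ≥ 3`, every `d`, every frozen-species count): unconditional. [folklore] [cite: LangerMattis1971, eqs. (4)–(5) (half filling)] -/
theorem torusBound_holds : TorusBound :=
  torusBound_of_rankTwoFloorQF rankTwoFloorQF_holds

/-- **PDB-L in the 2D thermodynamic limit at every rational density `0 ≤ n ≤ 2`, `U ≥ 0`**:
unconditional. [folklore] [cite: ValentiStolzeHirschfeld1991, bound type (b) (the printed class off half filling)] -/
theorem tlBoundRat_holds : TLBoundRat :=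
  tlBoundRat_of_rankTwoFloorQF rankTwoFloorQF_holds


end PauliDoublon

end Summit.Ventures.CertifiedManyBodySolver.Lower
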